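import Mathlib.Topology.Algebra.Category.ProfiniteGrp.Completion
import Mathlib.GroupTheory.FreeGroup.Basic
import Mathlib.Data.ZMod.Basic
import Mathlib.Algebra.BigOperators.Group.Finset.Basic
import Mathlib.Algebra.BigOperators.Ring.Finset
import Literature.AnabelianGeometry.SemiGraphs.TemperedAnabelian
import Literature.GroupTheory.CombinatorialGroupTheory.FreeGroupSubgroupSeparable
import Literature.GroupTheory.CombinatorialGroupTheory.FreeGroupFoxCocycle
import HarnessLib

/-!
# Conjugates of a basis element of a free group inside its profinite completion

Companion (theorems only) of `Literature/AnabelianGeometry/SemiGraphs/TemperedAnabelian.lean`,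
second of three files discharging the named fact `FreeGroupNormallyTerminalInCompletion`
([SemiAnbd] Lemma 6.1 (i): `N_{F̂}(F) = F` for a free group `F` of rank `> 1`; abc-iut node
`SemiAnbd:Lem6.1(i)`, DISCHARGE-L3 item G14).  [cite: MochizukiSemiAnbd2006, Lem. 6.1(i) p.69]

Main result `exists_forall_coord_mul_inv_mem_zpowers`: if `g ∈ F̂` (Mathlib's
`ProfiniteGrp.ProfiniteCompletion.completion`) conjugates the image of a basis element `a` of
`F = F(α)` onto the image of some `y ∈ F`, then there is `u ∈ F` such that every finite-quotient
coordinate of `g·ι(u)⁻¹` is the class of a power of `y` — i.e. `g ∈ cl(ι⟨y⟩)·ι(u)`.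

Route (ours; the printed proof, [André, Lem. 3.2.1], goes through conjugacy separability and
centralisers instead): for each finite-index normal `K ⊴ F` take the affine Fox cocycle
`d : F → (ℤ/ℓ)[F/K]` of `FreeGroupFoxCocycle.lean`, refine `K` by the kernel of the affine action
and lift `g` there to `γ ∈ F`; the conjugation relation yields `d(y) = (1 - ȳ)·d(γ) + δ_{g_K}`,
and summing over right `⟨ȳ⟩`-cosets (which kills `(1 - ȳ)·(ℤ/ℓ)[F/K]`) gives the
**coset-sum identity** `Σ_t ε_t [ū_t s̄⁻¹ ∈ ⟨ȳ⟩] = [g_K s̄⁻¹ ∈ ⟨ȳ⟩]` for the Fox data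
`(ε_t, u_t)` of `y`.  M. Hall's separability of the cyclic subgroup `⟨y⟩` (tree:
`FreeGroupSubgroupSeparable`) makes the left side independent of `K` below a fixed `K⋆`, and a
modulus `ℓ` exceeding the total Fox mass turns the congruence into an equality of integers, which
pins the coset of `g_K` to that of a fixed `u_{t₀}` for all `K`.
-/

namespace Literature.AnabelianGeometry.SemiGraphs

open CategoryTheory ProfiniteGrp ProfiniteGrp.ProfiniteCompletion
open Literature.GroupTheory.CombinatorialGroupTheory

universe u

variable {α : Type u}

/-! ### Small list lemmas -/

/-- Interchanging a finite sum with a list sum. [folklore] -/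
private theorem sum_mul_list_sum {ι Q R : Type*} [Fintype Q] [CommRing R] (c : Q → R)
    (L : List ι) (f : ι → Q → R) :
    ∑ h, c h * (L.map fun p => f p h).sum = (L.map fun p => ∑ h, c h * f p h).sum := by
  induction L with
  | nil => simp
  | cons p L ih => simp [mul_add, Finset.sum_add_distrib, ih]

/-- A signed indicator sum over a list is bounded by the total mass. [folklore] -/
private theorem abs_list_sum_ite_le {β : Type*} (L : List (ℤ × β)) (c : ℤ × β → Prop)
    [DecidablePred c] :
    |(L.map fun p => if c p then p.1 else 0).sum| ≤ ((L.map fun p => p.1.natAbs).sum : ℕ) := by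
  induction L with
  | nil => simp
  | cons p L ih =>
    simp only [List.map_cons, List.sum_cons, Nat.cast_add]
    refine (abs_add_le _ _).trans (add_le_add ?_ ih)
    split_ifs
    · rw [Int.natCast_natAbs]
    · simp

/-- Casting a signed indicator sum over a list. [folklore] -/
private theorem cast_list_sum_ite {β R : Type*} [Ring R] (L : List (ℤ × β)) (c : ℤ × β → Prop)
    [DecidablePred c] :
    (((L.map fun p => if c p then p.1 else 0).sum : ℤ) : R) =
      (L.map fun p => if c p then (p.1 : R) else 0).sum := by
  induction L with
  | nil => simp
  | cons p L ih =>
    simp only [List.map_cons, List.sum_cons, Int.cast_add, ih]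
    split_ifs <;> simp

/-- A non-vanishing indicator sum has a contributing term. [folklore] -/
private theorem exists_of_list_sum_ite_ne_zero {γ R : Type*} [AddMonoid R] (L : List γ)
    (c : γ → Prop) [DecidablePred c] (f : γ → R)
    (h : (L.map fun p => if c p then f p else 0).sum ≠ 0) : ∃ p ∈ L, c p := by
  by_contra hne
  push Not at hne
  apply h
  rw [List.map_congr_left (fun p hp => if_neg (hne p hp))]
  simp

/-- An integer congruent to `1` modulo `ℓ` and within `ℓ` of `1` is `1`. [folklore] -/
private theorem int_eq_one_of_cast_eq_one {ℓ : ℕ} {n : ℤ} (h : (n : ZMod ℓ) = 1)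
    (hb : |n - 1| < ℓ) : n = 1 := by
  have h' : ((n : ℤ) : ZMod ℓ) = ((1 : ℤ) : ZMod ℓ) := by rw [h, Int.cast_one]
  rw [ZMod.intCast_eq_intCast_iff_dvd_sub] at h'
  have := Int.eq_zero_of_abs_lt_dvd h' (by rw [abs_sub_comm]; exact hb)
  omega

/-! ### The coset-sum identity -/

open scoped Classical in
/-- **Coset-sum identity.**  Let `g ∈ F̂` conjugate the basis element `a` onto `ι(y)`, `y ∈ F`,
and let `(ε_t, u_t)_t` be the Fox data of `y`.  For every finite-index normal `K ⊴ F`, every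
modulus `ℓ ≥ 1` and every `s ∈ F`, writing `H̄ = ⟨ȳ⟩ ≤ F/K`:
`Σ_t ε_t · [ū_t s̄⁻¹ ∈ H̄] = [g_K s̄⁻¹ ∈ H̄]` in `ℤ/ℓ`.  (Apply the `H̄`-right-coset sums, which
kill `(1 - ȳ)·R[F/K]`, to the cocycle identity `d(y) = (1 - ȳ)·d(γ) + δ_{g_K}` obtained from a
representative `γ` of `g` modulo the kernel of the affine action.) [folklore] -/
private theorem fox_coset_identity (a : α) (g : completion (GrpCat.of (FreeGroup α)))
    (y : FreeGroup α)
    (hy : toProfiniteCompletion (FreeGroup α) y =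
      g * toProfiniteCompletion (FreeGroup α) (FreeGroup.of a) * g⁻¹)
    (L : List (ℤ × FreeGroup α))
    (hL : ∀ (Q : Type u) [Group Q] [DecidableEq Q] (R : Type) [CommRing R]
      (π : FreeGroup α →* Q) (d : FreeGroup α → Q → R),
      d (FreeGroup.of a) 1 = 1 → (∀ h, h ≠ 1 → d (FreeGroup.of a) h = 0) →
      (∀ b, b ≠ a → d (FreeGroup.of b) = 0) →
      (∀ u v, d (u * v) = d u + fun h => d v ((π u)⁻¹ * h)) →
      d y = fun h => (L.map fun p => if π p.2 = h then (p.1 : R) else 0).sum)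
    (K : FiniteIndexNormalSubgroup (FreeGroup α)) (ℓ : ℕ) [NeZero ℓ] (s : FreeGroup α) :
    (L.map fun p => if (QuotientGroup.mk (p.2 * s⁻¹) : FreeGroup α ⧸ K.toSubgroup) ∈
        (Subgroup.zpowers y).map (QuotientGroup.mk' K.toSubgroup) then (p.1 : ZMod ℓ) else 0).sum =
      if (g * (toProfiniteCompletion (FreeGroup α) s)⁻¹).val K ∈
        (Subgroup.zpowers y).map (QuotientGroup.mk' K.toSubgroup) then (1 : ZMod ℓ) else 0 := by
  let π : FreeGroup α →* FreeGroup α ⧸ K.toSubgroup := QuotientGroup.mk' K.toSubgroup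
  have hπ : ∀ x : FreeGroup α, π x = (x : FreeGroup α ⧸ K.toSubgroup) := fun _ => rfl
  set Hbar := (Subgroup.zpowers y).map (QuotientGroup.mk' K.toSubgroup) with hHbar
  haveI : Fintype (FreeGroup α ⧸ K.toSubgroup) := Fintype.ofFinite _
  -- the cocycle and the Fox expansion of `d y`
  obtain ⟨d, N, hd1, hd1', hdb, hcoc, hN⟩ :=
    exists_affine_cocycle (Q := FreeGroup α ⧸ K.toSubgroup) (R := ZMod ℓ) π a
  have hdy := hL (FreeGroup α ⧸ K.toSubgroup) (ZMod ℓ) π d hd1 hd1' hdb hcoc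
  -- refinement `K₁ = K ⊓ N` and a representative `γ` of `g` modulo `K₁`
  let K₁ : FiniteIndexNormalSubgroup (FreeGroup α) := K ⊓ N
  obtain ⟨γ, hγ⟩ : ∃ γ : FreeGroup α, (γ : FreeGroup α ⧸ K₁.toSubgroup) = g.val K₁ :=
    QuotientGroup.mk_surjective _
  have hγK : (γ : FreeGroup α ⧸ K.toSubgroup) = g.val K := by
    have h1 : QuotientGroup.map K₁.toSubgroup K.toSubgroup (MonoidHom.id _)
        (inf_le_left : K₁ ≤ K) (g.val K₁) = g.val K :=
      g.property (homOfLE (inf_le_left : K₁ ≤ K))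
    rw [← hγ] at h1
    exact h1
  -- the conjugation relation modulo `K₁`
  have hrel : ((y : FreeGroup α) : FreeGroup α ⧸ K₁.toSubgroup) =
      ((γ * FreeGroup.of a * γ⁻¹ : FreeGroup α) : FreeGroup α ⧸ K₁.toSubgroup) := by
    have h1 := congrArg (fun x : completion (GrpCat.of (FreeGroup α)) => x.val K₁) hy
    have h2 : (g * toProfiniteCompletion (FreeGroup α) (FreeGroup.of a) * g⁻¹).val K₁ =
        g.val K₁ * (toProfiniteCompletion (FreeGroup α) (FreeGroup.of a)).val K₁ * (g.val K₁)⁻¹ :=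
      rfl
    simp only at h1
    rw [h2, ← hγ] at h1
    exact h1
  have hk : y⁻¹ * (γ * FreeGroup.of a * γ⁻¹) ∈ K₁.toSubgroup := QuotientGroup.eq.1 hrel
  have hkK : y⁻¹ * (γ * FreeGroup.of a * γ⁻¹) ∈ K := (inf_le_left : K₁ ≤ K) hk
  have hkN : y⁻¹ * (γ * FreeGroup.of a * γ⁻¹) ∈ N := (inf_le_right : K₁ ≤ N) hk
  -- `d` at `1` and at `γ⁻¹`
  have hd_one : d 1 = 0 := by
    have h11 := hcoc 1 1
    simp only [mul_one, map_one, inv_one, one_mul] at h11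
    ext h
    have := congrFun h11 h
    simp only [Pi.add_apply] at this
    simpa using this
  have hdinv : ∀ h, d γ⁻¹ h = -d γ (π γ * h) := by
    intro h
    have := congrFun (hcoc γ⁻¹ γ) h
    rw [inv_mul_cancel, hd_one] at this
    simp only [Pi.zero_apply, Pi.add_apply, map_inv, inv_inv] at this
    exact eq_neg_of_add_eq_zero_left this.symm
  have hπconj : π (γ * FreeGroup.of a * γ⁻¹) = π y := by
    have : π (y⁻¹ * (γ * FreeGroup.of a * γ⁻¹)) = 1 := (QuotientGroup.eq_one_iff _).2 hkK
    rw [map_mul, map_inv, inv_mul_eq_one] at this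
    exact this.symm
  -- (★) the cocycle identity `d y = d γ + δ_{πγ} - (π y)·d γ`, pointwise
  have hstar : ∀ h, d y h = d γ h + (if (π γ)⁻¹ * h = 1 then 1 else 0) - d γ ((π y)⁻¹ * h) := by
    intro h
    have e1 : d (γ * FreeGroup.of a * γ⁻¹) = d y := by
      have : γ * FreeGroup.of a * γ⁻¹ = y * (y⁻¹ * (γ * FreeGroup.of a * γ⁻¹)) := by group
      rw [this, hcoc y, hN _ hkN]
      ext h'
      simp
    have e2 := congrFun (hcoc (γ * FreeGroup.of a) γ⁻¹) h
    have e3 := congrFun (hcoc γ (FreeGroup.of a)) h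
    simp only [Pi.add_apply] at e2 e3
    have e4 : π γ * ((π (γ * FreeGroup.of a))⁻¹ * h) = (π y)⁻¹ * h := by
      rw [← hπconj, map_mul, map_mul, map_mul, map_inv]
      group
    have e5 : d (FreeGroup.of a) ((π γ)⁻¹ * h) = if (π γ)⁻¹ * h = 1 then 1 else 0 := by
      split_ifs with hh
      · rw [hh, hd1]
      · exact hd1' _ hh
    rw [← e1, e2, e3, hdinv, e4, e5]
    ring
  -- the coset functional `Φ f = ∑ h, c h * f h`
  let c : FreeGroup α ⧸ K.toSubgroup → ZMod ℓ := fun h => if h * (π s)⁻¹ ∈ Hbar then 1 else 0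
  have hπy : π y ∈ Hbar := Subgroup.mem_map_of_mem _ (Subgroup.mem_zpowers y)
  have hc_inv : ∀ h, c ((π y)⁻¹ * h) = c h := by
    intro h
    simp only [c, mul_assoc]
    rw [Subgroup.mul_mem_cancel_left _ (Hbar.inv_mem hπy)]
  have hΦ_inv : ∀ f : FreeGroup α ⧸ K.toSubgroup → ZMod ℓ,
      ∑ h, c h * f ((π y)⁻¹ * h) = ∑ h, c h * f h := fun f =>
    Fintype.sum_equiv (Equiv.mulLeft (π y)⁻¹) _ _ (fun h => by
      simp only [Equiv.coe_mulLeft, hc_inv])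
  -- `Φ (d y) = c (π γ)`
  have hsum : ∑ h, c h * d y h = c (π γ) := by
    simp only [hstar, mul_add, mul_sub, Finset.sum_add_distrib, Finset.sum_sub_distrib,
      hΦ_inv (d γ), add_sub_cancel_left]
    simp only [inv_mul_eq_one, mul_ite, mul_one, mul_zero]
    rw [Finset.sum_ite_eq]
    simp
  -- `Φ (d y)` through the Fox expansion
  have hsum' : ∑ h, c h * d y h =
      (L.map fun p => if π p.2 * (π s)⁻¹ ∈ Hbar then (p.1 : ZMod ℓ) else 0).sum := by
    rw [hdy]
    rw [sum_mul_list_sum c L (fun p h => if π p.2 = h then (p.1 : ZMod ℓ) else 0)]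
    congr 1
    apply List.map_congr_left
    intro p _
    simp only [mul_ite, mul_zero]
    rw [Finset.sum_ite_eq]
    simp only [Finset.mem_univ, if_true, c]
    split_ifs <;> simp
  -- assemble
  have lhs : (L.map fun p => if (QuotientGroup.mk (p.2 * s⁻¹) : FreeGroup α ⧸ K.toSubgroup) ∈
        Hbar then (p.1 : ZMod ℓ) else 0).sum =
      (L.map fun p => if π p.2 * (π s)⁻¹ ∈ Hbar then (p.1 : ZMod ℓ) else 0).sum := rfl
  have hval : (g * (toProfiniteCompletion (FreeGroup α) s)⁻¹).val K = π γ * (π s)⁻¹ := by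
    have e : (g * (toProfiniteCompletion (FreeGroup α) s)⁻¹).val K =
        g.val K * ((toProfiniteCompletion (FreeGroup α) s).val K)⁻¹ := rfl
    rw [e, ← hγK]
    rfl
  rw [lhs, ← hsum', hsum, hval]
  rfl

/-! ### Conjugates of a basis element in the profinite completion -/

/-- Representatives descend along `K ≤ L` (local copy of the coordinate bookkeeping). [folklore] -/
private theorem rep_of_le' (x : completion (GrpCat.of (FreeGroup α)))
    {K L : FiniteIndexNormalSubgroup (FreeGroup α)} (h : K ≤ L) {γ : FreeGroup α}
    (hγ : (γ : FreeGroup α ⧸ K.toSubgroup) = x.val K) :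
    (γ : FreeGroup α ⧸ L.toSubgroup) = x.val L := by
  have h1 : QuotientGroup.map K.toSubgroup L.toSubgroup (MonoidHom.id _) h (x.val K) = x.val L :=
    x.property (homOfLE h)
  rw [← hγ] at h1
  exact h1

open scoped Classical in
/-- **Conjugates of a basis element in `F̂`** (the key step of our proof of [SemiAnbd]
Lemma 6.1 (i)).  If `g ∈ F̂` conjugates the image of the basis element `a` of the free group
`F = F(α)` onto the image of `y ∈ F`, then `g ∈ cl(ι⟨y⟩)·ι(u)` for some `u ∈ F`; stated
coordinatewise: every coordinate of `g·ι(u)⁻¹` is the class of a power of `y`.  Proof: the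
coset-sum identity, M. Hall's separability of `⟨y⟩` (tree: `FreeGroupSubgroupSeparable`) applied to
the finitely many quotients `u_t u_{t'}⁻¹` of the Fox data, and a modulus `ℓ` exceeding the total
Fox mass, pin the right `⟨ȳ⟩`-coset of `g_K` to that of a fixed `u_{t₀}` for all deep `K`.
[cite: MochizukiSemiAnbd2006, Lem. 6.1(i) p.69] -/
theorem exists_forall_coord_mul_inv_mem_zpowers (a : α)
    (g : completion (GrpCat.of (FreeGroup α))) (y : FreeGroup α)
    (hy : toProfiniteCompletion (FreeGroup α) y =
      g * toProfiniteCompletion (FreeGroup α) (FreeGroup.of a) * g⁻¹) :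
    ∃ u : FreeGroup α, ∀ K : FiniteIndexNormalSubgroup (FreeGroup α),
      ∃ z ∈ Subgroup.zpowers y, (z : FreeGroup α ⧸ K.toSubgroup) =
        (g * (toProfiniteCompletion (FreeGroup α) u)⁻¹).val K := by
  obtain ⟨L, hL⟩ := exists_fox_data a y
  have hid := fun K ℓ hℓ s => @fox_coset_identity α a g y hy L hL K ℓ hℓ s
  set H := Subgroup.zpowers y with hH
  have hHfg : H.FG := ⟨{y}, by rw [Finset.coe_singleton, hH, Subgroup.zpowers_eq_closure]⟩
  -- the exceptional finite set and Hall's normal subgroup `P`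
  let A : Set (FreeGroup α) :=
    {x | x ∈ ((L ×ˢ L).map fun pp : (ℤ × FreeGroup α) × (ℤ × FreeGroup α) =>
      pp.1.2 * pp.2.2⁻¹) ∧ x ∉ H}
  have hAfin : A.Finite := (List.finite_toSet _).subset fun x hx => hx.1
  have hHA : Disjoint (H : Set (FreeGroup α)) A :=
    Set.disjoint_left.2 fun x hxH hxA => hxA.2 hxH
  obtain ⟨P, hPn, hPf, hdisj⟩ :=
    Literature.GroupTheory.CombinatorialGroupTheory.exists_normal_finiteIndex_disjoint_sup
      H hHfg A hAfin hHA
  haveI := hPn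
  haveI := hPf
  let Kstar : FiniteIndexNormalSubgroup (FreeGroup α) := FiniteIndexNormalSubgroup.ofSubgroup P
  -- below `Kstar`, membership of the Fox quotients in `⟨ȳ⟩` is decided in `F`
  have hsep : ∀ K : FiniteIndexNormalSubgroup (FreeGroup α), K ≤ Kstar → ∀ p ∈ L, ∀ p' ∈ L,
      ((QuotientGroup.mk (p.2 * p'.2⁻¹) : FreeGroup α ⧸ K.toSubgroup) ∈
        H.map (QuotientGroup.mk' K.toSubgroup) ↔ p.2 * p'.2⁻¹ ∈ H) := by
    intro K hK p hp p' hp'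
    constructor
    · rintro ⟨h, hhH, hh⟩
      by_contra hx
      have hxA : p.2 * p'.2⁻¹ ∈ A :=
        ⟨List.mem_map.2 ⟨(p, p'), List.pair_mem_product.2 ⟨hp, hp'⟩, rfl⟩, hx⟩
      have hk : h⁻¹ * (p.2 * p'.2⁻¹) ∈ K.toSubgroup := QuotientGroup.eq.1 hh
      have hxHP : p.2 * p'.2⁻¹ ∈ H ⊔ P := by
        have : p.2 * p'.2⁻¹ = h * (h⁻¹ * (p.2 * p'.2⁻¹)) := by group
        rw [this]
        exact Subgroup.mul_mem _ (Subgroup.mem_sup_left hhH) (Subgroup.mem_sup_right (hK hk))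
      exact Set.disjoint_left.1 hdisj hxHP hxA
    · intro hx
      exact ⟨_, hx, rfl⟩
  -- the modulus
  set M : ℕ := (L.map fun p => p.1.natAbs).sum with hM
  set ℓ : ℕ := M + 2 with hℓ
  haveI hℓ0 : NeZero ℓ := ⟨by omega⟩
  haveI : Fact (1 < ℓ) := ⟨by omega⟩
  -- a representative of `g` modulo `Kstar` and the base point `u₀`
  obtain ⟨γs, hγs⟩ : ∃ γs : FreeGroup α, (γs : FreeGroup α ⧸ Kstar.toSubgroup) = g.val Kstar :=
    QuotientGroup.mk_surjective _
  have hvalK : ∀ v : FreeGroup α, (g * (toProfiniteCompletion (FreeGroup α) v)⁻¹).val Kstar =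
      ((γs * v⁻¹ : FreeGroup α) : FreeGroup α ⧸ Kstar.toSubgroup) := by
    intro v
    have e : (g * (toProfiniteCompletion (FreeGroup α) v)⁻¹).val Kstar =
        g.val Kstar * ((toProfiniteCompletion (FreeGroup α) v).val Kstar)⁻¹ := rfl
    rw [e, ← hγs]
    rfl
  have h1 : (L.map fun p => if (QuotientGroup.mk (p.2 * γs⁻¹) : FreeGroup α ⧸ Kstar.toSubgroup) ∈
      H.map (QuotientGroup.mk' Kstar.toSubgroup) then (p.1 : ZMod ℓ) else 0).sum = 1 := by
    rw [hid Kstar ℓ hℓ0 γs, hvalK γs, mul_inv_cancel, if_pos]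
    exact one_mem _
  obtain ⟨p₀, hp₀L, hp₀⟩ := exists_of_list_sum_ite_ne_zero L _ (fun p => (p.1 : ZMod ℓ))
    (by rw [h1]; exact one_ne_zero)
  set u₀ := p₀.2 with hu₀
  have h2 : (L.map fun p => if (QuotientGroup.mk (p.2 * u₀⁻¹) : FreeGroup α ⧸ Kstar.toSubgroup) ∈
      H.map (QuotientGroup.mk' Kstar.toSubgroup) then (p.1 : ZMod ℓ) else 0).sum = 1 := by
    rw [hid Kstar ℓ hℓ0 u₀, hvalK u₀, if_pos]
    have := Subgroup.inv_mem _ hp₀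
    rw [← QuotientGroup.mk_inv, mul_inv_rev, inv_inv] at this
    exact this
  -- the integer count `n₀` and its value `1`
  set n₀ : ℤ := (L.map fun p => if p.2 * u₀⁻¹ ∈ H then p.1 else 0).sum with hn₀
  have hLK : ∀ K : FiniteIndexNormalSubgroup (FreeGroup α), K ≤ Kstar →
      (L.map fun p => if (QuotientGroup.mk (p.2 * u₀⁻¹) : FreeGroup α ⧸ K.toSubgroup) ∈
        H.map (QuotientGroup.mk' K.toSubgroup) then (p.1 : ZMod ℓ) else 0).sum = (n₀ : ZMod ℓ) := by
    intro K hK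
    rw [hn₀, cast_list_sum_ite]
    congr 1
    apply List.map_congr_left
    intro p hp
    rw [if_congr (hsep K hK p hp p₀ hp₀L) rfl rfl]
  have hn₀1 : n₀ = 1 := by
    apply int_eq_one_of_cast_eq_one (ℓ := ℓ)
    · rw [← hLK Kstar le_rfl, h2]
    · have hb := abs_list_sum_ite_le L (fun p => p.2 * u₀⁻¹ ∈ H)
      rw [← hM, ← hn₀] at hb
      calc |n₀ - 1| ≤ |n₀| + |(1 : ℤ)| := abs_sub _ _
        _ ≤ (M : ℤ) + 1 := by rw [abs_one]; exact add_le_add hb le_rfl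
        _ < ℓ := by rw [hℓ]; push_cast; linarith
  -- conclusion below `Kstar`
  have hle : ∀ K : FiniteIndexNormalSubgroup (FreeGroup α), K ≤ Kstar →
      (g * (toProfiniteCompletion (FreeGroup α) u₀)⁻¹).val K ∈
        H.map (QuotientGroup.mk' K.toSubgroup) := by
    intro K hK
    by_contra hnot
    have := hid K ℓ hℓ0 u₀
    rw [hLK K hK, hn₀1, if_neg hnot, Int.cast_one] at this
    exact one_ne_zero this
  -- all coordinates
  refine ⟨u₀, fun K => ?_⟩
  obtain ⟨z, hzH, hz⟩ := hle (K ⊓ Kstar) inf_le_right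
  exact ⟨z, hzH, rep_of_le' _ inf_le_left hz⟩

end Literature.AnabelianGeometry.SemiGraphs
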